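import Summits.CriticalPhenomena.PercolationContinuityZ3.Theorems.PercNearOneGluingNoHeavyPcintBSMXSiteMoments
import Summits.CriticalPhenomena.PercolationContinuityZ3.Theorems.PercNearOneGluingNoHeavyPcintBSMXAssembly
import Literature.Probability.Percolation.SiteSharpnessDecay
import Literature.Probability.Percolation.SiteCoveringStrictMonotonicityAssembly
import HarnessLib

/-!
# PCINT lane, PHASE 8 (block renewal, SITE version), step 3: the site certificate theorem

Cell `prim-pcint`, seat `prim-pcint-1` (gen 16); memo `run/shared/lean/prim/pcint/T-FIBRE-ROUTE.md` §PHASE 8.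

**`BSMX.siteCriticalProb_le_of_cert5V`**, the SITE analogue of `BSMX.criticalProb_le_of_cert5` (…PcintBSMXAssembly):
same block words (reach-two transverse pieces in `ℤ^t`, one step along one of `k ≥ 2` time axes), same pair-offset
chain and Green data (`BSMX.TailBoundH`, `BSMX.V0H/V1H`), but the reward is the number of shared VERTICES of the
blocks (`BSMX.RlocV`, …PcintBSMXSiteBridge): at time offset zero it is the transverse count
**`BSMX.SV pc k y σ σ' = |Vst σ ∩ (y + Vst σ')|`** (start vertex included) in BOTH branches of the time-axis choice
(`BSMX.RlocV_zero`; no shared time edge term).  If for every `y ∈ [-4,4]^t`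

  `Σ_{σ,σ'} w σ w σ' [ (1/k) (x^{SV} - 1) V̂₀(u) + ((k-1)/k) (x^{SV} - 1) V̂₁(u) ] ≤ φ y`   (`BSMX.certLHSV`)

then `A RlocV ≤ V₀(0)/c` (`BSM.A_le_of_cert'`), `P^site_p(0 ⟷ ∂ⁱⁿB(0,m)) ≥ c/V₀(0)` for every `m`
(`BSMX.le_real_exitEventV`), `θ^site(p) > 0` (`tendsto_siteTheta`) and **`p_c^site(ℤ^{k+t}) ≤ p`**.
The vertex keys must lie in the reach-two cube (`BSMX.VertCube2`, decidable).
-/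

noncomputable section

namespace Summit.CriticalPhenomena.PercolationContinuityZ3.Theorems.Pcint.BSMX

open Finset Filter Topology OSM BSM MeasureTheory Literature.Probability.Percolation Literature.Probability.LatticeModels

variable {t k np : ℕ}

/-! ### The transverse shared-vertex count and the reach-two box -/

/-- **The transverse shared-vertex count** of two pieces at transverse offset `y` (start vertices included). -/
def SV (pc : Fin np → List (Fin t × Bool)) (k : ℕ) (y : Fin t → ℤ) (σ σ' : Fin np) : ℕ :=
  (insert ((0 : Fin k → ℤ), (0 : Fin t → ℤ)) (tverts k 0 (pc σ)) ∩
    (insert ((0 : Fin k → ℤ), (0 : Fin t → ℤ)) (tverts k 0 (pc σ'))).map (shiftV y)).card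

/-- **The site reward at time offset zero** is the transverse count, whatever the time axes. -/
theorem RlocV_zero (pc : Fin np → List (Fin t × Bool)) (y : Fin t → ℤ) (σ σ' : Fin np) (a a' : Fin k) :
    RlocV pc ((0 : Fin k → ℤ), y) (σ, a) (σ', a') = SV pc k y σ σ' := by
  rw [RlocV, if_pos rfl]; rfl

/-- **Vertex keys in the reach-two cube**: every entered vertex of a piece has coordinates in `[-2, 2]`. -/
def VertCube2 (pc : Fin np → List (Fin t × Bool)) (k : ℕ) : Prop :=
  ∀ σ, ∀ q ∈ tverts k 0 (pc σ), ∀ i, -2 ≤ q.2 i ∧ q.2 i ≤ 2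

/-- All vertex keys of a block lie in the reach-two cube. -/
theorem vert_cube2 {pc : Fin np → List (Fin t × Bool)} (hvc : VertCube2 pc k) (b : Blk np k)
    {q : VKey t k} (hq : q ∈ Vst pc b) (i : Fin t) : -2 ≤ q.2 i ∧ q.2 i ≤ 2 := by
  rw [Vst, mem_insert] at hq
  rcases hq with rfl | hq
  · simp
  · exact hvc b.1 q hq i

/-- The site rewards vanish outside `{0} × [-4,4]^t`. -/
theorem mem_box_of_RlocV_ne_zero2 {pc : Fin np → List (Fin t × Bool)} (hvc : VertCube2 pc k)
    {o : Off t k} {b b' : Blk np k} (h : RlocV pc o b b' ≠ 0) :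
    o ∈ (Box t 4).image (fun y => ((0 : Fin k → ℤ), y)) := by
  rw [mem_image]
  refine ⟨o.2, ?_, Prod.ext (fst_eq_zero_of_RlocV_ne_zero pc h).symm rfl⟩
  obtain ⟨q, hq, q', hq', hqq⟩ := exists_of_RlocV_ne_zero pc h
  rw [mem_Box]
  intro i
  have h1 := vert_cube2 hvc b hq i
  have h2 := vert_cube2 hvc b' hq' i
  have : o.2 i = q.2 i - q'.2 i := by rw [hqq]; simp
  rw [this]
  push_cast
  constructor <;> linarith [h1.1, h1.2, h2.1, h2.2]

/-! ### The site certificate functional -/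

/-- **The site certificate functional** at the transverse offset `y` (reward `x^{SV}` in both branches). -/
def certLHSV (pc : Fin np → List (Fin t × Bool)) (w : Fin np → ℝ) (k : ℕ) (x : ℝ) (V0f V1f : (Fin t → ℤ) → ℝ)
    (y : Fin t → ℤ) : ℝ :=
  ∑ σ : Fin np, ∑ σ' : Fin np, w σ * w σ' *
    ((1 / (k : ℝ)) * (x ^ SV pc k y σ σ' - 1) * V0f (y + (pend (pc σ') - pend (pc σ))) +
      ((k : ℝ) - 1) / k * (x ^ SV pc k y σ σ' - 1) * V1f (y + (pend (pc σ') - pend (pc σ))))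

/-- **The pair estimate.** -/
theorem pair_sum_le5V (hk : 2 ≤ k) {pc : Fin np → List (Fin t × Bool)} {w : Fin np → ℝ} {a₁ a₂ : ℝ}
    (hc : Cube2 pc) (hm : Marg5 pc w a₁ a₂) (hw : ∀ σ, 0 ≤ w σ) {x : ℝ} (hx : 1 ≤ x)
    {N : ℕ} {T : ℝ} (hT : TailBoundH t k a₁ a₂ N T) (c : ℝ) (φ : (Fin t → ℤ) → ℝ) (hφ : ∀ y, 0 ≤ φ y)
    {V0f V1f : (Fin t → ℤ) → ℝ}
    (hV0 : ∀ u ∈ Box t 8, V0H k a₁ a₂ N T c φ u ≤ V0f u) (hV1 : ∀ u ∈ Box t 8, V1H k a₁ a₂ N T c φ u ≤ V1f u) (m : ℕ)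
    {y : Fin t → ℤ} (hy : y ∈ Box t 4) (σ σ' : Fin np) :
    ∑ a : Fin k, ∑ a' : Fin k, νw k w (σ, a) * νw k w (σ', a') *
        (x ^ RlocV pc ((0 : Fin k → ℤ), y) (σ, a) (σ', a') - 1) *
          (c + ∑ z ∈ Box t 4, Gm pc (νw k w) m ((((0 : Fin k → ℤ), y) : Off t k) + δ pc (σ, a) (σ', a')) (0, z) * φ z) ≤
      w σ * w σ' * ((1 / (k : ℝ)) * (x ^ SV pc k y σ σ' - 1) * V0f (y + (pend (pc σ') - pend (pc σ))) +
        ((k : ℝ) - 1) / k * (x ^ SV pc k y σ σ' - 1) * V1f (y + (pend (pc σ') - pend (pc σ)))) := by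
  have hk0 : 0 < k := by omega
  have hu4 : y + (pend (pc σ') - pend (pc σ)) ∈ Box t 8 := mem_Box8 hc hy σ σ'

  have hkR : (0 : ℝ) < k := by exact_mod_cast hk0
  set uo : Fin t → ℤ := y + (pend (pc σ') - pend (pc σ)) with huo
  set Sv : ℕ := SV pc k y σ σ' with hSv
  set K : ℝ := w σ * w σ' / (k : ℝ) ^ 2 with hK
  have hK0 : 0 ≤ K := by rw [hK]; exact div_nonneg (mul_nonneg (hw σ) (hw σ')) (by positivity)
  have hxS : 0 ≤ x ^ Sv - 1 := sub_nonneg.2 (one_le_pow₀ hx)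
  -- the Green sums appearing
  set Gz : Fin k → Fin k → (Fin t → ℤ) → ℝ := fun a a' z => Gm pc (νw k w) m (e a' - e a, uo) (0, z) with hGz
  -- the diagonal value and the off-diagonal terms
  set Dval : ℝ := K * (x ^ Sv - 1) * (c + ∑ z ∈ Box t 4, Gm pc (νw k w) m (0, uo) (0, z) * φ z) with hD
  set Oterm : Fin k → Fin k → ℝ := fun a a' => K * (x ^ Sv - 1) * (c + ∑ z ∈ Box t 4, Gz a a' z * φ z) with hO
  have hterm : ∀ a a' : Fin k, νw k w (σ, a) * νw k w (σ', a') *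
      (x ^ RlocV pc ((0 : Fin k → ℤ), y) (σ, a) (σ', a') - 1) *
        (c + ∑ z ∈ Box t 4, Gm pc (νw k w) m ((((0 : Fin k → ℤ), y) : Off t k) + δ pc (σ, a) (σ', a')) (0, z) * φ z) =
      if a = a' then Dval else Oterm a a' := by
    intro a a'
    rw [RlocV_zero, offset_pair]
    have hνν : νw k w (σ, a) * νw k w (σ', a') = K := by simp only [νw, hK]; ring
    rw [hνν]
    by_cases haa : a = a'
    · subst haa
      rw [if_pos rfl, hD, sub_self]
    · rw [if_neg haa, hO]
  simp_rw [hterm]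
  -- split the double sum
  have hsplit : ∑ a : Fin k, ∑ a' : Fin k, (if a = a' then Dval else Oterm a a') =
      (k : ℝ) * Dval + ∑ a : Fin k, ∑ a' : Fin k, (if a = a' then 0 else Oterm a a') := by
    have : ∀ a a' : Fin k, (if a = a' then Dval else Oterm a a') =
        (if a = a' then Dval else 0) + (if a = a' then 0 else Oterm a a') := by
      intro a a'; split_ifs <;> simp
    simp_rw [this, sum_add_distrib, sum_ite_eq, if_pos (mem_univ _), sum_const, card_univ, Fintype.card_fin,
      nsmul_eq_mul]
  rw [hsplit]
  -- the diagonal part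
  have hdiag : (k : ℝ) * Dval ≤ w σ * w σ' * ((1 / (k : ℝ)) * (x ^ Sv - 1) * V0f uo) := by
    have hG : c + ∑ z ∈ Box t 4, Gm pc (νw k w) m (0, uo) (0, z) * φ z ≤ V0f uo := by
      refine le_trans ?_ (hV0 uo hu4)
      unfold V0H
      refine add_le_add le_rfl (sum_le_sum fun z _ => mul_le_mul_of_nonneg_right ?_ (hφ z))
      rw [Gm_zero_eq5 hc hm hk0]
      exact (hT.2 m (z - uo)).1
    calc (k : ℝ) * Dval = (k : ℝ) * (K * (x ^ Sv - 1)) *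
          (c + ∑ z ∈ Box t 4, Gm pc (νw k w) m (0, uo) (0, z) * φ z) := by rw [hD]; ring
      _ ≤ (k : ℝ) * (K * (x ^ Sv - 1)) * V0f uo :=
          mul_le_mul_of_nonneg_left hG (mul_nonneg hkR.le (mul_nonneg hK0 hxS))
      _ = w σ * w σ' * ((1 / (k : ℝ)) * (x ^ Sv - 1) * V0f uo) := by
          rw [hK]; field_simp
  -- the off-diagonal part
  have hoff : ∑ a : Fin k, ∑ a' : Fin k, (if a = a' then 0 else Oterm a a') ≤
      w σ * w σ' * (((k : ℝ) - 1) / k * (x ^ Sv - 1) * V1f uo) := by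
    -- pull out the constant factor
    have e1 : ∑ a : Fin k, ∑ a' : Fin k, (if a = a' then 0 else Oterm a a') =
        K * (x ^ Sv - 1) * ∑ a : Fin k, ∑ a' : Fin k, (if a = a' then 0 else (c + ∑ z ∈ Box t 4, Gz a a' z * φ z)) := by
      rw [mul_sum]; refine sum_congr rfl fun a _ => ?_
      rw [mul_sum]; refine sum_congr rfl fun a' _ => ?_
      rw [hO]; split_ifs <;> simp
    -- the inner double sum
    have e2 : ∑ a : Fin k, ∑ a' : Fin k, (if a = a' then 0 else (c + ∑ z ∈ Box t 4, Gz a a' z * φ z)) =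
        ((k : ℝ) ^ 2 - k) * c + ∑ z ∈ Box t 4, φ z *
          ∑ a : Fin k, ∑ a' : Fin k, (if a = a' then 0 else Gm pc (νw k w) m (e a' - e a, uo) (0, z)) := by
      have : ∀ a a' : Fin k, (if a = a' then (0 : ℝ) else (c + ∑ z ∈ Box t 4, Gz a a' z * φ z)) =
          (if a = a' then (0 : ℝ) else c) + ∑ z ∈ Box t 4, φ z * (if a = a' then 0 else Gz a a' z) := by
        intro a a'
        split_ifs
        · simp
        · rw [add_left_cancel_iff.2 (sum_congr rfl fun z _ => mul_comm _ _)]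
      simp_rw [this, sum_add_distrib]
      congr 1
      · -- `Σ_{a,a'} [a ≠ a'] c = (k² - k) c`
        have hc' : ∀ a a' : Fin k, (if a = a' then (0 : ℝ) else c) = c - (if a = a' then c else 0) := by
          intro a a'; split_ifs <;> ring
        simp_rw [hc', sum_sub_distrib, sum_ite_eq, if_pos (mem_univ _), sum_const, card_univ, Fintype.card_fin,
          nsmul_eq_mul]
        ring
      · rw [← Fintype.sum_prod_type', sum_comm]
        refine sum_congr rfl fun z _ => ?_
        rw [← Fintype.sum_prod_type', ← mul_sum]
    -- bound the adjacent Green sums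
    have e3 : ∀ z : Fin t → ℤ, ∑ a : Fin k, ∑ a' : Fin k,
        (if a = a' then 0 else Gm pc (νw k w) m (e a' - e a, uo) (0, z)) ≤
          (k : ℝ) * ((k : ℝ) - 1) * (G1H k a₁ a₂ N (z - uo) + T) := by
      intro z
      rw [sum_Gm_adj_eq5 hc hm hk0]
      have hk1 : (0 : ℝ) < (k : ℝ) * ((k : ℝ) - 1) := by
        have : (2 : ℝ) ≤ k := by exact_mod_cast hk
        nlinarith
      have hre : ∑ i ∈ range m, ((k : ℝ) ^ 2 * u k (i + 1) - k * u k i) * ∏ l, H a₁ a₂ (2 * i) (z l - uo l) =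
          (k : ℝ) * ((k : ℝ) - 1) * ∑ i ∈ range m, cadj k i * ∏ l, H a₁ a₂ (2 * i) ((z - uo) l) := by
        rw [mul_sum]
        refine sum_congr rfl fun i _ => ?_
        have hk1' : (k : ℝ) - 1 ≠ 0 := by
          have : (2 : ℝ) ≤ k := by exact_mod_cast hk
          intro h; linarith
        have hkk : (k : ℝ) ≠ 0 := ne_of_gt hkR
        have hp : ∏ l, H a₁ a₂ (2 * i) ((z - uo) l) = ∏ l, H a₁ a₂ (2 * i) (z l - uo l) := rfl
        rw [hp, cadj]
        field_simp
      rw [hre]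
      exact mul_le_mul_of_nonneg_left (hT.2 m (z - uo)).2 hk1.le
    have hk1 : (0 : ℝ) ≤ (k : ℝ) * ((k : ℝ) - 1) := by
      have : (2 : ℝ) ≤ k := by exact_mod_cast hk
      nlinarith
    have e4 : ((k : ℝ) ^ 2 - k) * c + ∑ z ∈ Box t 4, φ z *
        ∑ a : Fin k, ∑ a' : Fin k, (if a = a' then 0 else Gm pc (νw k w) m (e a' - e a, uo) (0, z)) ≤
        (k : ℝ) * ((k : ℝ) - 1) * V1f uo := by
      refine le_trans ?_ (mul_le_mul_of_nonneg_left (hV1 uo hu4) hk1)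
      unfold V1H
      rw [mul_add, mul_sum]
      refine add_le_add (by nlinarith) (sum_le_sum fun z _ => ?_)
      calc φ z * ∑ a : Fin k, ∑ a' : Fin k, (if a = a' then 0 else Gm pc (νw k w) m (e a' - e a, uo) (0, z))
          ≤ φ z * ((k : ℝ) * ((k : ℝ) - 1) * (G1H k a₁ a₂ N (z - uo) + T)) :=
            mul_le_mul_of_nonneg_left (e3 z) (hφ z)
        _ = (k : ℝ) * ((k : ℝ) - 1) * ((G1H k a₁ a₂ N (z - uo) + T) * φ z) := by ring
    rw [e1, e2]
    calc K * (x ^ Sv - 1) * (((k : ℝ) ^ 2 - k) * c + ∑ z ∈ Box t 4, φ z *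
          ∑ a : Fin k, ∑ a' : Fin k, (if a = a' then 0 else Gm pc (νw k w) m (e a' - e a, uo) (0, z)))
        ≤ K * (x ^ Sv - 1) * ((k : ℝ) * ((k : ℝ) - 1) * V1f uo) :=
          mul_le_mul_of_nonneg_left e4 (mul_nonneg hK0 hxS)
      _ = w σ * w σ' * (((k : ℝ) - 1) / k * (x ^ Sv - 1) * V1f uo) := by rw [hK]; field_simp
  calc (k : ℝ) * Dval + ∑ a : Fin k, ∑ a' : Fin k, (if a = a' then 0 else Oterm a a')
      ≤ w σ * w σ' * ((1 / (k : ℝ)) * (x ^ Sv - 1) * V0f uo) +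
        w σ * w σ' * (((k : ℝ) - 1) / k * (x ^ Sv - 1) * V1f uo) := add_le_add hdiag hoff
    _ = _ := by ring

/-! ### The certificate theorem -/

/-- **The site certificate theorem**: a passed site certificate gives `p_c^site(ℤ^{k+t}) ≤ p`. -/
theorem siteCriticalProb_le_of_cert5V (hk : 2 ≤ k) {pc : Fin np → List (Fin t × Bool)} {w : Fin np → ℝ}
    {a₁ a₂ : ℝ} (hcube : Cube2 pc) (hvc : VertCube2 pc k) (hm : Marg5 pc w a₁ a₂) (hw : ∀ σ, 0 ≤ w σ)
    {p : ℝ} (hp0 : 0 < p) (hp1 : p ≤ 1) {N : ℕ} {T : ℝ} (hT : TailBoundH t k a₁ a₂ N T) {c : ℝ} (hc : 0 < c)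
    (φ : (Fin t → ℤ) → ℝ) (hφ : ∀ y, 0 ≤ φ y) {V0f V1f : (Fin t → ℤ) → ℝ}
    (hV0 : ∀ u ∈ Box t 8, V0H k a₁ a₂ N T c φ u ≤ V0f u) (hV1 : ∀ u ∈ Box t 8, V1H k a₁ a₂ N T c φ u ≤ V1f u)
    (hcert : ∀ y ∈ Box t 4, certLHSV pc w k (1 / p) V0f V1f y ≤ φ y) :
    siteCriticalProb (zdGraph (k + t)) (0 : Site (k + t)) ≤ p := by
  have hk0 : 0 < k := by omega
  have hx : 1 ≤ 1 / p := by rw [le_div_iff₀ hp0]; linarith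
  have hν0 : ∀ b : Blk np k, 0 ≤ νw k w b := fun b => div_nonneg (hw b.1) (Nat.cast_nonneg k)
  have hν1 : ∑ b : Blk np k, νw k w b = 1 := sum_νw hk0 (sum_w_of_marg5 hm)
  set B : Finset (Off t k) := (Box t 4).image (fun y => ((0 : Fin k → ℤ), y)) with hB
  have hsumB : ∀ f : Off t k → ℝ, ∑ z ∈ B, f z = ∑ y ∈ Box t 4, f ((0 : Fin k → ℤ), y) := by
    intro f
    rw [hB, sum_image]
    intro y _ y' _ h
    exact (Prod.mk.inj h).2
  -- the certificate condition of `A_le_of_cert'`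
  have hcert' : ∀ m, ∀ o ∈ B, ∑ b : Blk np k, ∑ b' : Blk np k,
      νw k w b * νw k w b' * ((1 / p) ^ RlocV pc o b b' - 1) *
        (c + ∑ z ∈ B, Gm pc (νw k w) m (o + δ pc b b') z * φ z.2) ≤ φ o.2 := by
    intro m o ho
    obtain ⟨y, hy, rfl⟩ := mem_image.1 ho
    simp_rw [hsumB]
    simp only [Fintype.sum_prod_type]
    calc ∑ σ : Fin np, ∑ a : Fin k, ∑ σ' : Fin np, ∑ a' : Fin k, νw k w (σ, a) * νw k w (σ', a') *
          ((1 / p) ^ RlocV pc ((0 : Fin k → ℤ), y) (σ, a) (σ', a') - 1) *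
            (c + ∑ z ∈ Box t 4, Gm pc (νw k w) m ((((0 : Fin k → ℤ), y) : Off t k) + δ pc (σ, a) (σ', a'))
              ((0 : Fin k → ℤ), z) * φ z)
        = ∑ σ : Fin np, ∑ σ' : Fin np, ∑ a : Fin k, ∑ a' : Fin k, νw k w (σ, a) * νw k w (σ', a') *
          ((1 / p) ^ RlocV pc ((0 : Fin k → ℤ), y) (σ, a) (σ', a') - 1) *
            (c + ∑ z ∈ Box t 4, Gm pc (νw k w) m ((((0 : Fin k → ℤ), y) : Off t k) + δ pc (σ, a) (σ', a'))
              ((0 : Fin k → ℤ), z) * φ z) := sum_congr rfl fun σ _ => sum_comm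
      _ ≤ certLHSV pc w k (1 / p) V0f V1f y :=
          sum_le_sum fun σ _ => sum_le_sum fun σ' _ =>
            pair_sum_le5V hk hcube hm hw hx hT c φ hφ hV0 hV1 m hy σ σ'
      _ ≤ φ y := hcert y hy
  -- `A ≤ V₀(0)/c`
  have hV0ge : ∀ n, c + ∑ z ∈ B, Gm pc (νw k w) n 0 z * φ z.2 ≤ V0H k a₁ a₂ N T c φ 0 := by
    intro n
    rw [hsumB]
    unfold V0H
    refine add_le_add le_rfl (sum_le_sum fun z _ => mul_le_mul_of_nonneg_right ?_ (hφ z))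
    have h0 : (0 : Off t k) = ((0 : Fin k → ℤ), (0 : Fin t → ℤ)) := rfl
    rw [h0, Gm_zero_eq5 hcube hm hk0]
    exact (hT.2 n (z - 0)).1
  have hA : ∀ n, A (RlocV pc) pc (νw k w) (1 / p) n 0 ≤ V0H k a₁ a₂ N T c φ 0 / c := fun n =>
    (A_le_of_cert' (RlocV pc) pc hν0 hν1 hx B (fun o b b' h => mem_box_of_RlocV_ne_zero2 hvc h)
      (φ := fun o => φ o.2) (fun z _ => hφ z.2) hc hcert' n).trans (div_le_div_of_nonneg_right (hV0ge n) hc.le)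
  have hV0 : 0 < V0H k a₁ a₂ N T c φ 0 := by
    have := hV0ge 0
    have h2 : 0 ≤ ∑ z ∈ B, Gm pc (νw k w) 0 0 z * φ z.2 :=
      sum_nonneg fun z _ => mul_nonneg (sum_nonneg fun i _ => Pn_nonneg pc hν0 i _ _) (hφ z.2)
    linarith
  -- `θ^site(p) ≥ c / V₀(0) > 0`
  set pI : unitInterval := ⟨p, hp0.le, hp1⟩
  have hball : ∀ m : ℕ, c / V0H k a₁ a₂ N T c φ 0 ≤ (sitePercolation (Site (k + t)) pI).real
      (exitEvent (zdGraph (k + t)) (DCTQ.ball (zdGraph (k + t)) (0 : Site (k + t)) m) (0 : Site (k + t))) := by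
    intro m
    refine le_trans ?_ (le_real_exitEventV pc hν0 hν1 pI hp0 m)
    have hApos : 0 < A (RlocV pc) pc (νw k w) (1 / p) (m + 2) 0 :=
      lt_of_lt_of_le one_pos (one_le_A (RlocV pc) pc hν0 hν1 hx (m + 2) 0)
    calc c / V0H k a₁ a₂ N T c φ 0 = 1 / (V0H k a₁ a₂ N T c φ 0 / c) := by rw [one_div_div]
      _ ≤ 1 / A (RlocV pc) pc (νw k w) (1 / p) (m + 2) 0 := one_div_le_one_div_of_le hApos (hA (m + 2))
  -- the graph balls exhaust `ℤ^{k+t}`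
  have hmono : Monotone (fun j : ℕ => DCTQ.ball (zdGraph (k + t)) (0 : Site (k + t)) j) := fun a b hab =>
    DCTQ.ball_mono 0 hab
  have hex : ∀ v : Site (k + t), ∃ j, v ∈ DCTQ.ball (zdGraph (k + t)) (0 : Site (k + t)) j := fun v => by
    obtain ⟨q⟩ := zdGraph_preconnected_holds (d := k + t) (0 : Site (k + t)) v
    exact ⟨q.length, DCTQ.mem_ball_of_walk q le_rfl⟩
  have h00 : (0 : Site (k + t)) ∈ DCTQ.ball (zdGraph (k + t)) (0 : Site (k + t)) 0 := DCTQ.mem_ball_self _ _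
  have hlim := tendsto_siteTheta (G := zdGraph (k + t)) hmono hex h00 pI
  have heq : ∀ j : ℕ, (⋂ i ≤ j, exitEvent (zdGraph (k + t)) (DCTQ.ball (zdGraph (k + t)) (0 : Site (k + t)) i)
      (0 : Site (k + t))) = exitEvent (zdGraph (k + t)) (DCTQ.ball (zdGraph (k + t)) (0 : Site (k + t)) j) (0 : Site (k + t)) := by
    intro j
    apply Set.Subset.antisymm
    · intro ω hω; exact (Set.mem_iInter₂.1 hω) j le_rfl
    · exact Set.subset_iInter₂ fun i hi => exitEvent_anti (hmono hi) (DCTQ.mem_ball_self _ _)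
  simp_rw [heq] at hlim
  have hθ : c / V0H k a₁ a₂ N T c φ 0 ≤ siteTheta (zdGraph (k + t)) (0 : Site (k + t)) pI := ge_of_tendsto' hlim hball
  have hθpos : 0 < siteTheta (zdGraph (k + t)) (0 : Site (k + t)) pI := lt_of_lt_of_le (div_pos hc hV0) hθ
  exact SiteOrbitQuotient.siteCriticalProb_le_of_siteTheta_pos (zdGraph (k + t)) 0 pI hθpos

end Summit.CriticalPhenomena.PercolationContinuityZ3.Theorems.Pcint.BSMX

end
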